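import Literature.MathematicalPhysics.QuantumFieldTheory.Balaban1983to89.BlockAveragingEMLProp1Iter
import Literature.MathematicalPhysics.QuantumFieldTheory.Balaban1983to89.B10Eq70Squaring

/-!
# `Balaban1983to89.BlockAveragingEMLEq71` — [Balaban1985UV3] p. 273, **(67)–(71) FOR THE AVERAGING OF RECORD**: the small factor `exp(−¼p²(g_j))` per large plaquette of an
# `N`-fold (0.4)-average with the printed `exp[mean log]` ([Balaban1987RG1]), from the transport-plan form of (69) (✓`BlockAveragingEMLProp1Iter`) and the tree's (70)–(71)
# arithmetic (`B10.eq70_sq_step`, `B10Eq70Squaring.ineq71`) — `d = 3`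

T. Bałaban, *Ultraviolet stability of three-dimensional lattice pure gauge field theories*, Commun. Math. Phys. **102** (1985) 255–275 [Balaban1985UV3] (cell paper B10;
journal page = PDF page + 254), p. 273, verbatim: *«Let us take a plaquette p′ ⊂ Λ_j and such that |V_j(∂p′) − 1| ≥ g_jp(g_j). We have (67) Ū_k^j = V_j on Λ_j, and the
configuration U_k satisfies the following regularity condition on B^j(Λ_j). (68) |U_k(∂p) − 1| < O(1)g_jp(g_j)L^{−2j}. Applying the inequalities (50), (53) [4], we have (69) …
Squaring both sides of the above inequality and using (67) yields (70) … This inequality can be written finally as (71) (1/g_k²) Σ_{p⊂Δ′} η⁻¹[1 − Re tr U_k(∂p)] ≥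
(1/2g_j²)|V_j(∂p′) − 1|² − O(1)g_jp³(g_j) ≥ ½p²(g_j) − O(1)g_jp³(g_j) ≥ ¼p²(g_j) for g_j sufficiently small. Thus the part of the action … localized to the sum of four
j-blocks Δ′ … can be bounded from below by ¼p²(g_j), and the corresponding part of the exponential gives the small factor exp(−¼p²(g_j)).»*; [Balaban1987RG1] CMP **109**
(1987), (0.3)–(0.4) pp. 252–253 (the symmetric averaging with `exp[mean log]`) and p. 253 *«valid universally for all averages satisfying the above properties»*.

Cell `ym3-torus` (rung R3 = SU(2) YM₃ on T³ — NOT d = 4, NOT infinite volume, NOT a mass gap, NOT Clay), width seat «width 8» `ym3-torus-px8` (gen 27),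
`--supports stmt-QuantumFields-20520`; HOME `UV3-NODE.md` §69.20 (4)(a): input (a) of the (m)_E node's atomic letters — the per-large-plaquette small factor — FOR THE AVERAGING OF
RECORD (0.4).  The tree certifies (67)–(71) for [B7]'s own linear average (42)–(43) on `ℤ³` and on the torus (`B10Eq71Concrete`, `B10Eq69TorusPullback`,
`B10Eq71TorusLocal`); this file is the (0.4) twin, built on the transport-plan form of (69) for the nonlinear iterates (✓`BlockAveragingEMLProp1Iter.exists_transportWeights`).

WHAT THIS FILE PROVES (kernel, 0 `sorry`, one theorem, no definitions): ★★★`smallFactor_of_largeField_eml` — `d = 3`; successive (0.4)-averages `V_j, …, V_{j+N}` on the torus with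
the windows of the plan theorem; (67)–(68) as hypotheses in print's currency (`g_j·p ≤ |V_{j+N}(∂p′) − 1|`, `|V_j(∂q) − 1| ≤ C₁·g_jp/(L^N)²` at the finest level, the accumulated
second-order term `≤ C₂·(g_jp)²`), (11) `|V_j(∂q) − 1|² ≤ 2·act q`, `g_k² = g_j²·L^{k−N}`, «`g_j` sufficiently small» `(2C₁C₂ + C₂²)/2·g_jp ≤ ¼` ⟹
**`¼p² ≤ (1/g_k²)·L^k·Σ_q act q`** over the finest plaquettes of the orientation.  Chain: (69) = the plan; `M ≤ C₁g_jp` by the OUTGOING total `L^{2N}`; `M² ≤ L^{2N}·L^{−N}·Σ|V_j − 1|²`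
by ONE Cauchy–Schwarz with the INCOMING total as multiplicity (print's `L^{j}`, `j ↦ N`); (70) cross terms = `B10.eq70_sq_step`; (71) = `B10Eq70Squaring.ineq71` (both the tree's,
unchanged).  DIFFERENCE FROM PRINT: the sum runs over ALL finest plaquettes of the orientation instead of `Δ′(p′)` — for (0.4) the chains drift over 3 × 3 top blocks (UV3-NODE
§69.20-B) and the summed form ✓`sum_sq_weightedSum_le` (same constant, no overlap count) is what «all plaquettes in all large fields set P» consumes.

HONEST FRAMING.  An assembly of landed kernel pieces; the regularity (68), the windows and the second-order budget are HYPOTHESES (print: the minimiser's regularity and Prop. 2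
(53)); nothing else of Bałaban's is asserted; the (m)_E atomic letters of `ym3-torus`'s line are NOT discharged (this completes their input (a) for the averaging of record;
(c), the relative cost of a large-field history, is the unprinted sentence); one finite torus at fixed lattice data — NOT continuum, NOT infinite volume, NOT a mass gap, NOT Clay.
-/

set_option autoImplicit false

noncomputable section

open scoped BigOperators

namespace Literature.MathematicalPhysics.QuantumFieldTheory.Balaban1983to89.BlockAveragingEMLEq71

open T4Continuum BlockAveraging AveragingRT B10Eq47AxialChi LatticeWordStokes BlockAveragingEMLProp2 BlockAveragingEMLProp1Iter
open ExpMeanLog NormedSpace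
open scoped Matrix.Norms.L2Operator

variable {n : Type*} [Fintype n] [DecidableEq n] [Nonempty n] {P : Params}

/-- ★★★ **(67)–(71) FOR THE `N`-FOLD SYMMETRIC AVERAGING (0.4), `d = 3`: THE LOCALISED ACTION BELOW A LARGE AVERAGED PLAQUETTE IS AT LEAST `¼p²`.**  Successive (0.4)-averages
`V_j, …, V_{j+N}` on the torus (standing range) with the windows of ✓`exists_transportWeights` (every plaquette of `V_{j+k}` within `a_k` of `1`, `(((d+4)L)²/4)·a_k ≤ δ_N/2`);
print's (67)–(68) in the form: the coarse plaquette at `y` is LARGE, `g_j·p ≤ |V_{j+N}(∂p′_y) − 1|`, the finest plaquettes are REGULAR, `|V_j(∂q_z) − 1| ≤ C₁·g_jp/(L^N)²`, and the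
accumulated second-order term is `≤ C₂·(g_jp)²`; (11) `|V_j(∂q_z) − 1|² ≤ 2·act z`; the couplings `g_k² = g_j²·L^{k−N}` (`N ≤ k`) and «for `g_j` sufficiently small»
`(2C₁C₂ + C₂²)/2·g_jp ≤ ¼`.  THEN `¼p² ≤ (1/g_k²)·L^k·Σ_z act z` — the sum over ALL finest plaquettes of the orientation (the localisation to `Δ′` is replaced by the transport plan's
incoming bound; for «all plaquettes in all large fields set P» use ✓`sum_sq_weightedSum_le` instead, with the SAME constant).  Chain: (69) = the plan (✓`exists_transportWeights`), `M ≤ C₁g_jp`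
by the outgoing total, `M² ≤ L^{2N}·L^{−N}·Σ_z |V_j(∂q_z) − 1|²` (✓`sq_weightedSum_le_mul`, ONE Cauchy–Schwarz — print's `L^{j}` with `j ↦ N`), (70) cross terms `B10.eq70_sq_step`, (71)
`B10Eq70Squaring.ineq71`.  Nothing else of Bałaban's asserted; windows and regularity are HYPOTHESES (print: (68) for the minimiser, Prop. 2 (53) for the windows).
[cite: Balaban1985UV3, (67)-(71) p.273; Balaban1985Averaging, Prop. 1 (50) p.25; Balaban1987RG1, (0.4) p.253] -/
theorem smallFactor_of_largeField_eml (hd : P.d = 3) (j : ℕ) {μ ν : Fin P.d} (hμν : μ < ν)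
    (V : (k : ℕ) → GaugeField P k (Matrix.specialUnitaryGroup n ℂ)) (a : ℕ → ℝ) (ha : ∀ k, 0 ≤ a k)
    (N : ℕ) (hrange : j + N ≤ P.m + P.K)
    (hV : ∀ k, k < N → V (j + k + 1) = avgFun (expMeanLogSU (n := n)) (V (j + k)))
    (hVa : ∀ k, k < N → ∀ q : Plaq P (j + k), dist1 (GaugeField.plaqHol (V (j + k)) q) ≤ a k)
    (hs : ∀ k, k < N → ((((P.d + 4) * P.L : ℕ) : ℝ) ^ 2 / 4) * a k ≤ deltaSU n / 2)
    (y : Site P (j + N)) {gj gk p C₁ C₂ : ℝ} {k : ℕ} (hgj : 0 < gj) (hp : 0 ≤ p) (hgp : gj * p ≤ 1) (hC₁ : 0 ≤ C₁) (hNk : N ≤ k)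
    (hgk : gk ^ 2 = gj ^ 2 * (P.L : ℝ) ^ (k - N))
    (hLF : gj * p ≤ dist1 (GaugeField.plaqHol (V (j + N)) ⟨y, μ, ν, hμν⟩))
    (h68 : ∀ z : Site P j, dist1 (GaugeField.plaqHol (V j) ⟨z, μ, ν, hμν⟩) ≤ C₁ * (gj * p) / (((P.L : ℝ) ^ N) ^ 2))
    (hE : ∑ k ∈ Finset.range N, ((P.L : ℝ) ^ 2) ^ (N - 1 - k) * (143 * (((((P.d + 4) * P.L : ℕ) : ℝ) ^ 2 / 4) * a k) ^ 2) ≤ C₂ * (gj * p) ^ 2)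
    (act : Site P j → ℝ) (hact : ∀ z : Site P j, dist1 (GaugeField.plaqHol (V j) ⟨z, μ, ν, hμν⟩) ^ 2 ≤ 2 * act z)
    (hsmall : (2 * C₁ * C₂ + C₂ ^ 2) / 2 * gj * p ≤ 1 / 4) :
    p ^ 2 / 4 ≤ (gk ^ 2)⁻¹ * ((P.L : ℝ) ^ k * ∑ z : Site P j, act z) := by
  obtain ⟨W, hW0, hWout, hWin, hWmain⟩ := exists_transportWeights j hμν V a ha N hrange hV hVa hs
  have hL0 : (0 : ℝ) < P.L := by exact_mod_cast P.L_pos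
  have hL1 : (P.L : ℝ) ≠ 0 := hL0.ne'
  -- names
  set v : ℝ := dist1 (GaugeField.plaqHol (V (j + N)) ⟨y, μ, ν, hμν⟩) with hv
  set dz : Site P j → ℝ := fun z => dist1 (GaugeField.plaqHol (V j) ⟨z, μ, ν, hμν⟩) with hdz
  set M : ℝ := ∑ z, W y z * dz z with hM
  set E : ℝ := ∑ k ∈ Finset.range N, ((P.L : ℝ) ^ 2) ^ (N - 1 - k) * (143 * (((((P.d + 4) * P.L : ℕ) : ℝ) ^ 2 / 4) * a k) ^ 2) with hEdef
  have hv0 : 0 ≤ v := GaugeGroup.dist1_nonneg _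
  have hd0 : ∀ z, 0 ≤ dz z := fun z => GaugeGroup.dist1_nonneg _
  have hE0 : 0 ≤ E := Finset.sum_nonneg fun k _ => mul_nonneg (pow_nonneg (pow_nonneg hL0.le 2) _) (by positivity)
  have hgp0 : 0 ≤ gj * p := by positivity
  -- (69): the plan's bound
  have h69 : v ≤ M + E := hWmain y
  -- `M ≤ C₁·g_jp`: outgoing total `L^{2N}` against the regular finest plaquettes `(68)`
  have hM0 : 0 ≤ M := Finset.sum_nonneg fun z _ => mul_nonneg (hW0 y z) (hd0 z)
  have hMA : M ≤ C₁ * (gj * p) := by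
    have hpow : ((P.L : ℝ) ^ 2) ^ N = ((P.L : ℝ) ^ N) ^ 2 := by rw [← pow_mul, ← pow_mul, mul_comm]
    have hLN : (0 : ℝ) < ((P.L : ℝ) ^ N) ^ 2 := by positivity
    calc M ≤ ∑ z, W y z * (C₁ * (gj * p) / ((P.L : ℝ) ^ N) ^ 2) := Finset.sum_le_sum fun z _ => mul_le_mul_of_nonneg_left (h68 z) (hW0 y z)
      _ = (∑ z, W y z) * (C₁ * (gj * p) / ((P.L : ℝ) ^ N) ^ 2) := by rw [Finset.sum_mul]
      _ ≤ ((P.L : ℝ) ^ 2) ^ N * (C₁ * (gj * p) / ((P.L : ℝ) ^ N) ^ 2) := by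
          exact mul_le_mul_of_nonneg_right (hWout y) (div_nonneg (mul_nonneg hC₁ hgp0) hLN.le)
      _ = C₁ * (gj * p) := by rw [hpow]; field_simp
  -- (70), first line: ONE Cauchy–Schwarz with the plan, multiplicity = incoming total `L^{−N}` at `d = 3`
  have hd2 : P.d - 2 = 1 := by omega
  have hCS : M ^ 2 ≤ (P.L : ℝ) ^ N * ∑ z, dz z ^ 2 := by
    have h := sq_weightedSum_le_mul W hW0 hWout hWin (pow_nonneg (pow_nonneg hL0.le 2) N) dz y
    have e : ((P.L : ℝ) ^ 2) ^ N * (((P.L : ℝ) ^ (P.d - 2))⁻¹) ^ N = (P.L : ℝ) ^ N := by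
      rw [hd2, pow_one, ← mul_pow]
      congr 1
      field_simp
    rw [e] at h
    exact h
  -- (11): `|U − 1|² ≤ 2·act`
  have h11 : ∑ z, dz z ^ 2 ≤ 2 * ∑ z, act z := by
    rw [Finset.mul_sum]
    exact Finset.sum_le_sum fun z _ => hact z
  -- (70), the cross terms
  have hsq : v ^ 2 ≤ (M + E) ^ 2 := pow_le_pow_left₀ hv0 h69 2
  have hstep := B10.eq70_sq_step M E (C₁ * (gj * p)) (C₂ * (gj * p) ^ 2) hM0 hMA hE0 hE
  have hcross : 2 * (C₁ * (gj * p)) * (C₂ * (gj * p) ^ 2) + (C₂ * (gj * p) ^ 2) ^ 2 ≤ (2 * C₁ * C₂ + C₂ ^ 2) * (gj * p) ^ 3 := by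
    have h4 : (gj * p) ^ 4 ≤ (gj * p) ^ 3 := by
      calc (gj * p) ^ 4 = (gj * p) ^ 3 * (gj * p) := by ring
        _ ≤ (gj * p) ^ 3 * 1 := mul_le_mul_of_nonneg_left hgp (by positivity)
        _ = (gj * p) ^ 3 := by ring
    have hC22 : 0 ≤ C₂ ^ 2 := sq_nonneg _
    nlinarith [mul_le_mul_of_nonneg_left h4 hC22]
  have hLN0 : 0 ≤ (P.L : ℝ) ^ N := pow_nonneg hL0.le N
  have h70 : v ^ 2 ≤ 2 * (P.L : ℝ) ^ N * (∑ z, act z) + (2 * C₁ * C₂ + C₂ ^ 2) * (gj * p) ^ 3 := by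
    nlinarith [mul_le_mul_of_nonneg_left h11 hLN0]
  -- (71)
  exact B10Eq70Squaring.ineq71 hL0 hNk hgj hgk hp hLF h70 hsmall

end Literature.MathematicalPhysics.QuantumFieldTheory.Balaban1983to89.BlockAveragingEMLEq71

end
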